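import Mathlib.Analysis.Quaternion
import HarnessLib

/-!
# Near-commuting unit quaternions are near a commuting family (Hölder exponent ½, constant free of the family size)

Pure quaternion algebra for the crux `ToronValleyVolume.LojasiewiczLocalise` (item stmt-QuantumFields-24498, LINE g15-B of
ym-idea-4): the almost-commuting ⇒ near-commuting step of the polynomial Łojasiewicz localisation of the periodic deficit.

* `normSq_comm_eq` — `|ab − ba|² = 4(|Im a|²|Im b|² − (Im a·Im b)²)` (Lagrange's identity: the commutator of two quaternions is twice the
  cross product of their imaginary parts);
* `exists_commuting_near_of_norm_comm_le` — ★ for ANY family `q : ι → ℍ` of unit quaternions with `‖q i * q j − q j * q i‖ ≤ η` for all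
  `i, j`, there is a pairwise-commuting family `y` of unit quaternions with `‖q i − y i‖ ≤ √η` for every `i` (project the imaginary parts on
  the axis of one member whose imaginary part has `|Im|² ≥ η/2`, re-normalising the real part; if there is none, snap everything to `±1`).

HONEST FRAMING: elementary algebra in `ℍ` (the imaginary dot product `Im a·Im b` is always written out as `a.imI*b.imI + a.imJ*b.imJ + a.imK*b.imK`);
nothing about the lattice, the deficit or Yang–Mills is proved here.  THEOREMS ONLY: no definition, no `sorry`.
-/

set_option autoImplicit false

noncomputable section

open scoped Quaternion

namespace Summit.QuantumFields.YangMills.Theorems.ToronValleyVolume.Lojasiewicz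

/-- `|Im a|²` as `(a.imI * a.imI + a.imJ * a.imJ + a.imK * a.imK)`. [folklore] -/
theorem imDot_self_eq (a : ℍ) : (a.imI * a.imI + a.imJ * a.imJ + a.imK * a.imK) = a.imI ^ 2 + a.imJ ^ 2 + a.imK ^ 2 := by
  ring

/-- Symmetry of the imaginary dot product. [folklore] -/
theorem imDot_comm (a b : ℍ) : (a.imI * b.imI + a.imJ * b.imJ + a.imK * b.imK) = (b.imI * a.imI + b.imJ * a.imJ + b.imK * a.imK) := by ring

/-- `0 ≤ |Im a|²`. [folklore] -/
theorem imDot_self_nonneg (a : ℍ) : 0 ≤ (a.imI * a.imI + a.imJ * a.imJ + a.imK * a.imK) := by rw [imDot_self_eq]; positivity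

/-- `‖a‖² = re² + |Im a|²`. [folklore] -/
theorem norm_sq_eq_re_sq_add_imDot (a : ℍ) : ‖a‖ ^ 2 = a.re ^ 2 + (a.imI * a.imI + a.imJ * a.imJ + a.imK * a.imK) := by
  rw [sq, ← Quaternion.normSq_eq_norm_mul_self, Quaternion.normSq_def', imDot_self_eq]; ring

/-- The commutator of two quaternions is purely imaginary with imaginary part `2 (Im a × Im b)`; its squared norm is
`4(|Im a|²|Im b|² − (Im a·Im b)²)` (Lagrange's identity). [folklore] -/
theorem normSq_comm_eq (a b : ℍ) :
    ‖a * b - b * a‖ ^ 2 = 4 * ((a.imI * a.imI + a.imJ * a.imJ + a.imK * a.imK) * (b.imI * b.imI + b.imJ * b.imJ + b.imK * b.imK) - (a.imI * b.imI + a.imJ * b.imJ + a.imK * b.imK) ^ 2) := by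
  rw [sq, ← Quaternion.normSq_eq_norm_mul_self, Quaternion.normSq_def']
  simp only [Quaternion.re_sub, Quaternion.imI_sub, Quaternion.imJ_sub, Quaternion.imK_sub, Quaternion.re_mul, Quaternion.imI_mul,
    Quaternion.imJ_mul, Quaternion.imK_mul]
  ring

/-- Two quaternions whose imaginary parts are real multiples of one vector commute. [folklore] -/
theorem mul_comm_of_im_parallel (n₁ n₂ n₃ s t s' t' : ℝ) :
    (⟨s, t * n₁, t * n₂, t * n₃⟩ : ℍ) * ⟨s', t' * n₁, t' * n₂, t' * n₃⟩ = (⟨s', t' * n₁, t' * n₂, t' * n₃⟩ : ℍ) * ⟨s, t * n₁, t * n₂, t * n₃⟩ := by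
  ext <;> simp <;> ring

/-- The sign `±1` of the real part squares to `1`. [folklore] -/
theorem signRe_sq (a : ℍ) : (if 0 ≤ a.re then (1:ℝ) else -1) ^ 2 = 1 := by
  split_ifs <;> norm_num

/-- `sign(re) · |re| = re`. [folklore] -/
theorem signRe_mul_abs_re (a : ℍ) : (if 0 ≤ a.re then (1:ℝ) else -1) * |a.re| = a.re := by
  split_ifs with h
  · rw [abs_of_nonneg h, one_mul]
  · rw [abs_of_neg (lt_of_not_ge h)]; ring

/-- `√(x² + w) − |x| ≤ √w` for `w ≥ 0`: re-normalising the real part costs at most the size of the removed imaginary component. [folklore] -/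
theorem sqrt_sq_add_sub_abs_le {x w : ℝ} (hw : 0 ≤ w) : Real.sqrt (x ^ 2 + w) - |x| ≤ Real.sqrt w := by
  have hs := Real.sqrt_nonneg w
  have h1 : x ^ 2 + w ≤ (|x| + Real.sqrt w) ^ 2 := by
    have e : (|x| + Real.sqrt w) ^ 2 = x ^ 2 + 2 * |x| * Real.sqrt w + Real.sqrt w ^ 2 := by
      have := sq_abs x
      nlinarith [this]
    rw [e, Real.sq_sqrt hw]
    nlinarith [abs_nonneg x]
  have h2 : Real.sqrt (x ^ 2 + w) ≤ |x| + Real.sqrt w := by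
    calc Real.sqrt (x ^ 2 + w) ≤ Real.sqrt ((|x| + Real.sqrt w) ^ 2) := Real.sqrt_le_sqrt h1
      _ = |x| + Real.sqrt w := Real.sqrt_sq (by positivity)
  linarith

/-- ★ **Near-commuting unit quaternions are near a commuting family.**  If `‖q i‖ = 1` for all `i` and `‖q i * q j − q j * q i‖ ≤ η` for all `i, j`,
then there is a pairwise-commuting family `y` of unit quaternions with `‖q i − y i‖ ≤ √η` for every `i`.  (Hölder exponent `½`; the constant does not
depend on the size of the family: project every imaginary part on the axis of one member with `|Im|² ≥ η/2`, or snap all members to `±1` if there is none.)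
[folklore] -/
theorem exists_commuting_near_of_norm_comm_le {ι : Type*} (q : ι → ℍ) {η : ℝ} (hη : 0 ≤ η) (h1 : ∀ i, ‖q i‖ = 1)
    (hc : ∀ i j, ‖q i * q j - q j * q i‖ ≤ η) :
    ∃ y : ι → ℍ, (∀ i, ‖y i‖ = 1) ∧ (∀ i j, y i * y j = y j * y i) ∧ ∀ i, ‖q i - y i‖ ≤ Real.sqrt η := by
  -- `re² + |Im|² = 1`
  have hunit : ∀ i, (q i).re ^ 2 + ((q i).imI * (q i).imI + (q i).imJ * (q i).imJ + (q i).imK * (q i).imK) = 1 := fun i => by rw [← norm_sq_eq_re_sq_add_imDot, h1 i, one_pow]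
  have hre1 : ∀ i, |(q i).re| ≤ 1 := fun i => by
    have := hunit i; have := imDot_self_nonneg (q i)
    rw [← sq_le_one_iff_abs_le_one]; linarith
  -- to bound `‖q i − y i‖` by `√η` it suffices to bound the square by `η`
  have key : ∀ (i : ι) (y : ℍ), ‖q i - y‖ ^ 2 ≤ η → ‖q i - y‖ ≤ Real.sqrt η := fun i y h =>
    (Real.le_sqrt (norm_nonneg _) hη).2 h
  -- a unit-norm criterion
  have unit_of_sq : ∀ y : ℍ, ‖y‖ ^ 2 = 1 → ‖y‖ = 1 := fun y h => by
    have h0 : 0 ≤ ‖y‖ := norm_nonneg _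
    nlinarith [h]
  by_cases hpiv : ∃ i₀, η / 2 ≤ ((q i₀).imI * (q i₀).imI + (q i₀).imJ * (q i₀).imJ + (q i₀).imK * (q i₀).imK)
  · -- Case A: project on the axis of the pivot `u`
    obtain ⟨i₀, hi₀⟩ := hpiv
    set u : ℍ := q i₀ with hu
    set m : ℝ := (u.imI * u.imI + u.imJ * u.imJ + u.imK * u.imK) with hm
    have hm0 : 0 ≤ m := imDot_self_nonneg u
    by_cases hmz : m = 0
    · -- then `η = 0`: the family already commutes; take `y = q`
      have hη0 : η = 0 := le_antisymm (by linarith) hη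
      refine ⟨q, h1, fun i j => ?_, fun i => by rw [sub_self, norm_zero]; exact Real.sqrt_nonneg _⟩
      have := hc i j; rw [hη0] at this
      exact sub_eq_zero.1 (norm_le_zero_iff.1 this)
    have hmpos : 0 < m := lt_of_le_of_ne hm0 (Ne.symm hmz)
    -- unit axis `n = Im u / √m`, projection coefficient `t i = (Im q i · Im u)/√m`
    set r : ℝ := Real.sqrt m with hr
    have hrpos : 0 < r := Real.sqrt_pos.2 hmpos
    have hr2 : r ^ 2 = m := Real.sq_sqrt hm0
    set n₁ : ℝ := u.imI / r with hn₁
    set n₂ : ℝ := u.imJ / r with hn₂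
    set n₃ : ℝ := u.imK / r with hn₃
    have hn : n₁ ^ 2 + n₂ ^ 2 + n₃ ^ 2 = 1 := by
      rw [hn₁, hn₂, hn₃, div_pow, div_pow, div_pow, ← add_div, ← add_div, ← imDot_self_eq, ← hm, hr2]
      exact div_self hmpos.ne'
    set t : ι → ℝ := fun i => ((q i).imI * u.imI + (q i).imJ * u.imJ + (q i).imK * u.imK) / r with ht
    have hdot : ∀ i, (q i).imI * n₁ + (q i).imJ * n₂ + (q i).imK * n₃ = t i := fun i => by
      rw [ht, hn₁, hn₂, hn₃]; dsimp only; field_simp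
    -- the removed (perpendicular) part: `|w i|² = |Im q i|² − t i² = (|Im q i|² m − (Im q i·Im u)²)/m ∈ [0, η/2]`
    have hW_eq : ∀ i, ((q i).imI * (q i).imI + (q i).imJ * (q i).imJ + (q i).imK * (q i).imK) - t i ^ 2 = (((q i).imI * (q i).imI + (q i).imJ * (q i).imJ + (q i).imK * (q i).imK) * m - ((q i).imI * u.imI + (q i).imJ * u.imJ + (q i).imK * u.imK) ^ 2) / m := fun i => by
      rw [ht]; dsimp only; rw [div_pow, hr2]; field_simp
    have hw : ∀ i, ((q i).imI * (q i).imI + (q i).imJ * (q i).imJ + (q i).imK * (q i).imK) - t i ^ 2 ≤ η / 2 := by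
      intro i
      have hsq : ‖q i * u - u * q i‖ ^ 2 ≤ η ^ 2 := by rw [hu]; exact pow_le_pow_left₀ (norm_nonneg _) (hc i i₀) 2
      rw [normSq_comm_eq, ← hm] at hsq
      rw [hW_eq, div_le_iff₀ hmpos]
      nlinarith [hi₀, hη]
    have hwnn : ∀ i, 0 ≤ ((q i).imI * (q i).imI + (q i).imJ * (q i).imJ + (q i).imK * (q i).imK) - t i ^ 2 := by
      intro i
      have hcs : ((q i).imI * u.imI + (q i).imJ * u.imJ + (q i).imK * u.imK) ^ 2 ≤ ((q i).imI * (q i).imI + (q i).imJ * (q i).imJ + (q i).imK * (q i).imK) * m := by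
        have := normSq_comm_eq (q i) u
        have h0 : 0 ≤ ‖q i * u - u * q i‖ ^ 2 := sq_nonneg _
        rw [hm]; linarith
      rw [hW_eq]; exact div_nonneg (by linarith) hm0
    -- the witness
    let y : ι → ℍ := fun i => ⟨(if 0 ≤ (q i).re then (1:ℝ) else -1) * Real.sqrt ((q i).re ^ 2 + (((q i).imI * (q i).imI + (q i).imJ * (q i).imJ + (q i).imK * (q i).imK) - t i ^ 2)), t i * n₁, t i * n₂, t i * n₃⟩
    have hy_re : ∀ i, (y i).re = (if 0 ≤ (q i).re then (1:ℝ) else -1) * Real.sqrt ((q i).re ^ 2 + (((q i).imI * (q i).imI + (q i).imJ * (q i).imJ + (q i).imK * (q i).imK) - t i ^ 2)) := fun i => rfl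
    have hy_I : ∀ i, (y i).imI = t i * n₁ := fun i => rfl
    have hy_J : ∀ i, (y i).imJ = t i * n₂ := fun i => rfl
    have hy_K : ∀ i, (y i).imK = t i * n₃ := fun i => rfl
    refine ⟨y, fun i => unit_of_sq _ ?_, fun i j => ?_, fun i => key i (y i) ?_⟩
    · -- unit norm: `(re² + |w|²) + t² (n·n) = re² + |Im|² = 1`
      rw [norm_sq_eq_re_sq_add_imDot, imDot_self_eq, hy_re, hy_I, hy_J, hy_K, mul_pow, signRe_sq, one_mul,
        Real.sq_sqrt (by have := hwnn i; positivity)]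
      linear_combination hunit i + t i ^ 2 * hn
    · exact mul_comm_of_im_parallel n₁ n₂ n₃ _ _ _ _
    · -- distance: `(re − re')² + |w|² ≤ 2|w|² ≤ η`
      have hwnn_i := hwnn i
      set W : ℝ := ((q i).imI * (q i).imI + (q i).imJ * (q i).imJ + (q i).imK * (q i).imK) - t i ^ 2 with hW
      -- real part
      have hre : ((q i).re - (if 0 ≤ (q i).re then (1:ℝ) else -1) * Real.sqrt ((q i).re ^ 2 + W)) ^ 2 ≤ W := by
        have e1 : (q i).re - (if 0 ≤ (q i).re then (1:ℝ) else -1) * Real.sqrt ((q i).re ^ 2 + W) = (if 0 ≤ (q i).re then (1:ℝ) else -1) * (|(q i).re| - Real.sqrt ((q i).re ^ 2 + W)) := by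
          rw [mul_sub, signRe_mul_abs_re]
        rw [e1, mul_pow, signRe_sq, one_mul]
        have h2 := sqrt_sq_add_sub_abs_le (x := (q i).re) hwnn_i
        have h3 : |(q i).re| ≤ Real.sqrt ((q i).re ^ 2 + W) := by
          rw [← Real.sqrt_sq_eq_abs]; exact Real.sqrt_le_sqrt (by linarith)
        have h4 : 0 ≤ Real.sqrt ((q i).re ^ 2 + W) - |(q i).re| := by linarith
        calc (|(q i).re| - Real.sqrt ((q i).re ^ 2 + W)) ^ 2 = (Real.sqrt ((q i).re ^ 2 + W) - |(q i).re|) ^ 2 := by ring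
          _ ≤ Real.sqrt W ^ 2 := pow_le_pow_left₀ h4 h2 2
          _ = W := Real.sq_sqrt hwnn_i
      -- imaginary part: `|Im q − t n|² = |Im q|² − 2t (Im q·n) + t² = |Im q|² − t²`
      have him : ((q i).imI - t i * n₁) ^ 2 + ((q i).imJ - t i * n₂) ^ 2 + ((q i).imK - t i * n₃) ^ 2 = W := by
        have hv : (q i).imI ^ 2 + (q i).imJ ^ 2 + (q i).imK ^ 2 = ((q i).imI * (q i).imI + (q i).imJ * (q i).imJ + (q i).imK * (q i).imK) := (imDot_self_eq _).symm
        rw [hW]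
        linear_combination hv - 2 * t i * hdot i + t i ^ 2 * hn
      rw [norm_sq_eq_re_sq_add_imDot, imDot_self_eq, Quaternion.re_sub, Quaternion.imI_sub, Quaternion.imJ_sub, Quaternion.imK_sub,
        hy_re, hy_I, hy_J, hy_K, ← hW]
      linarith [hre, him, hw i]
  · -- Case B: every imaginary part is small; snap to `±1`
    push Not at hpiv
    let y : ι → ℍ := fun i => ⟨(if 0 ≤ (q i).re then (1:ℝ) else -1), 0, 0, 0⟩
    have hy_re : ∀ i, (y i).re = (if 0 ≤ (q i).re then (1:ℝ) else -1) := fun i => rfl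
    have hy_I : ∀ i, (y i).imI = 0 := fun i => rfl
    have hy_J : ∀ i, (y i).imJ = 0 := fun i => rfl
    have hy_K : ∀ i, (y i).imK = 0 := fun i => rfl
    refine ⟨y, fun i => unit_of_sq _ ?_, fun i j => ?_, fun i => key i (y i) ?_⟩
    · rw [norm_sq_eq_re_sq_add_imDot, imDot_self_eq, hy_re, hy_I, hy_J, hy_K, signRe_sq]; ring
    · change (⟨(if 0 ≤ (q i).re then (1:ℝ) else -1), 0, 0, 0⟩ : ℍ) * ⟨(if 0 ≤ (q j).re then (1:ℝ) else -1), 0, 0, 0⟩ = (⟨(if 0 ≤ (q j).re then (1:ℝ) else -1), 0, 0, 0⟩ : ℍ) * ⟨(if 0 ≤ (q i).re then (1:ℝ) else -1), 0, 0, 0⟩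
      ext <;> simp [mul_comm]
    · have hv := hpiv i
      have hu := hunit i
      have ha := hre1 i
      -- `(re ∓ 1)² = (1 − |re|)² ≤ (1 − re²)² = |Im|⁴ ≤ |Im|²`, so `‖q − y‖² ≤ 2|Im|² < η`
      have e1 : ((q i).re - (if 0 ≤ (q i).re then (1:ℝ) else -1)) ^ 2 = (1 - |(q i).re|) ^ 2 := by
        split_ifs with h
        · rw [abs_of_nonneg h]; ring
        · rw [abs_of_neg (lt_of_not_ge h)]; ring
      have e2 : (1 - |(q i).re|) ^ 2 ≤ ((q i).imI * (q i).imI + (q i).imJ * (q i).imJ + (q i).imK * (q i).imK) := by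
        have hI : ((q i).imI * (q i).imI + (q i).imJ * (q i).imJ + (q i).imK * (q i).imK) = 1 - |(q i).re| ^ 2 := by rw [sq_abs]; linarith
        have h3 : 1 - |(q i).re| ≤ ((q i).imI * (q i).imI + (q i).imJ * (q i).imJ + (q i).imK * (q i).imK) := by
          rw [hI]; nlinarith [abs_nonneg (q i).re, ha]
        have h4 : 0 ≤ 1 - |(q i).re| := by linarith
        have h5 : 1 - |(q i).re| ≤ 1 := by linarith [abs_nonneg (q i).re]
        nlinarith [h3, h4, h5]
      rw [norm_sq_eq_re_sq_add_imDot, imDot_self_eq, Quaternion.re_sub, Quaternion.imI_sub, Quaternion.imJ_sub, Quaternion.imK_sub,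
        hy_re, hy_I, hy_J, hy_K, e1, sub_zero, sub_zero, sub_zero]
      rw [imDot_self_eq] at hv e2
      linarith


end Summit.QuantumFields.YangMills.Theorems.ToronValleyVolume.Lojasiewicz

end
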